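import Summits.ABC.IUTFork.Thm311RemarksSHE
import Summits.ABC.IUTFork.Thm311ToCor312Checks
import HarnessLib

/-!
# [IUTchIII] Theorem 3.11 in the author's terms, F2c: (SHE) as typed does not decide Cor. 3.12 — non-vacuity and independence (proof-only)

Record-only file (D-0012) of the abc-iut cell (seat abc-iut-c312-1); TAKES NO SIDE. PROOF-ONLY companion of
`Thm311RemarksSHE` (F2: `LinkData.SHELoop`, `Situation.SHEOutput`, `FullSituation.SHETyped`, `sheTyped_iff`)
over the gen-3 independence witness of `Thm311ToCor312Checks` (`Checks.idFull`, `Checks.idSetting`,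
`Checks.independence`, `Checks.no_sufficient_reading`):
* `Checks.id_sheTyped` — (SHE) as typed HOLDS in the witness (it is `IPL ∧ MultiradialCompat` there);
* `sheTyped_independence` — one model in which Theorem 3.11 as typed, (IPL), (SHE) as typed, `BridgeHyps`,
  `|log(q)| > 0`, the object-level pilot link and a region algorithm computing the Θ-regions ALL hold and the
  typed Cor. 3.12 `Cor312.Setting.Statement` FAILS;
* `no_sufficient_reading_of_sheTyped` — hence no condition on settings that is implied by (SHE)-as-typed (with
  the typed Theorem 3.11 and (IPL)) can be a sufficient reading for Cor. 3.12: every sufficient `G` fails at a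
  setting over a full situation where (SHE) as typed holds.
So of the readings tabulated in F2, only the one NOT typed there — the reading of record R3 / `Licence` ("the
codomain's `q`-pilot region is one of the possible images") — can carry the Step (xi-f) inference; whether the
printed (SHE) asserts it is the dispute, on which nothing here bears. [claim: Mochizuki2012, status: disputed]
-/

noncomputable section

namespace Summit.ABC.IUTFork

namespace Thm311ToCor312

open Thm311 Cor312 Cor312Vol

namespace Checks

/-- In the independence witness (`𝕋`, `idFull`: one-point index, identity data, constructed link) (SHE) as typed
holds — by `sheTyped_of_statement_of_ipl` from `id_statement` and `id_ipl`. [folklore] -/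
theorem id_sheTyped : idFull.SHETyped := idFull.sheTyped_of_statement_of_ipl id_statement id_ipl

/-- … and its two conjuncts separately: the closed loop of Rmk. 3.9.5 (ix) and the output reading. [folklore] -/
theorem id_sheLoop_and_sheOutput : idFull.link.SHELoop ∧ idFull.toSituation.SHEOutput := id_sheTyped

end Checks

/-- **(SHE) as typed, together with every typed premise, does not yield the typed Cor. 3.12**: in the gen-3
witness Theorem 3.11 as typed, (IPL), (SHE) as typed (`FullSituation.SHETyped`), move-invariance of the
log-volume, `BridgeHyps`, `|log(q)| > 0`, the object-level pilot link and a region algorithm computing the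
Θ-regions all hold, and `Cor312.Setting.Statement` fails (`Checks.independence` + `Checks.id_sheTyped`).
[folklore] -/
theorem sheTyped_independence :
    ∃ (T : ThetaIndex) (S : FullSituation T) (P : Setting S.toSituation),
      S.Statement ∧ S.link.IPL ∧ S.SHETyped ∧ (∀ n, (S.D n).LogvolInvariant) ∧
      BridgeHyps P ∧ P.AbsLogQPos ∧ PilotLink P ∧
      (∃ A : RegionAlgorithm S.toSituation, ComputedBy P A) ∧ ¬ P.Statement :=
  ⟨Checks.𝕋, Checks.idFull, Checks.idSetting, Checks.id_statement, Checks.id_ipl, Checks.id_sheTyped,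
    Checks.id_logvolInvariant, Checks.id_bridgeHyps, Checks.id_absLogQPos, Checks.id_pilotLink,
    ⟨Checks.zeroAlgorithm Checks.idSituation, Checks.id_computedBy⟩, Checks.id_not_statement⟩

/-- **No sufficient reading follows from (SHE) as typed.** If a condition `G` on Cor.-3.12 settings yields the
printed Statement under the bridge hypotheses (the readings of record R0–R4, `Licence`, volume transport, …),
then `G` FAILS at some setting over a full situation in which Theorem 3.11 as typed, (IPL) and (SHE) as typed
hold. (`Checks.no_sufficient_reading`, with (SHE) added to the list of premises the witness meets.) [folklore] -/
theorem no_sufficient_reading_of_sheTyped {G : ∀ {T : ThetaIndex} {S : Situation T}, Setting S → Prop}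
    (hG : ∀ {T : ThetaIndex} {S : Situation T} (P : Setting S), BridgeHyps P → G P → P.Statement) :
    ∃ (T : ThetaIndex) (S : FullSituation T) (P : Setting S.toSituation),
      S.Statement ∧ S.link.IPL ∧ S.SHETyped ∧ BridgeHyps P ∧ ¬ G P :=
  ⟨Checks.𝕋, Checks.idFull, Checks.idSetting, Checks.id_statement, Checks.id_ipl, Checks.id_sheTyped,
    Checks.id_bridgeHyps, fun h => Checks.id_not_statement (hG Checks.idSetting Checks.id_bridgeHyps h)⟩

end Thm311ToCor312

end Summit.ABC.IUTFork

end
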